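import Summits.ResolutionOfSingularities.ResolutionOfSingularities.Theorems.WildConesCampaignW46HypersurfacesCharTwoEmbDimStatement
import Summits.ResolutionOfSingularities.ResolutionOfSingularities.Theorems.WildConesCampaignW46HypersurfacesCharTwoSingularBranch

/-!
# [OURS · L1 W4.6, rung (ii) at p = 2, every dimension] The rev-2 embedding-dimension predicates
# (near point unique / exists, singular branch, polar corank) PROVED at `p = 2`, BY NAME, for every `n`

Cell res-hironaka (LADDER-RESOLUTION rung L, D-0089), slot W4.6, seat res-L1-s46-pv-4 (gen 3). Host: route
`WildCones`, crux `ClassicalRegimes` (stmt-ResolutionOfSingularities-16884; proved), `--supports … --as helper`.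

HONEST FRAMING. OURS throughout: the four predicates appended in rev 2 of
`Theorems/WildConesCampaignW46HypersurfacesCharTwoEmbDimStatement.lean` are closed here at `p = 2` for every
dimension `n` by one-line applications of `…HypersurfacesCharTwo{NearPoint,NearPointExists,SingularBranch,PolarRank}.lean`
(p503790, p505045, p505446, p502936). Nothing here is a statement of the manuscript [Hironaka2017]; no FACT-LIST
premise; every field of characteristic `2`. AI review is weaker than expert review.

* `campaignW46HypersurfacesEmbDimNearPointUnique_two n` — `CampaignW46HypersurfacesEmbDimNearPointUnique 2 n`
* `campaignW46HypersurfacesEmbDimNearPointExists_two n` — `CampaignW46HypersurfacesEmbDimNearPointExists 2 n`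
* `campaignW46HypersurfacesEmbDimSingularBranch_two n`  — `CampaignW46HypersurfacesEmbDimSingularBranch 2 n`
* `campaignW46HypersurfacesEmbDimPolarCorank_two n`     — `CampaignW46HypersurfacesEmbDimPolarCorank 2 n`

References: the statement file (rev 2); G.-M. Greuel, G. Pfister, J. Algebra 689 (2026) [GreuelPfister2026]; H.
Hironaka, ms. 2017 [Hironaka2017] Th. 16.6 p.84 / Th. 16.13 p.87 — role replaced only, under adjudication.
-/

noncomputable section

-- single-problem summit: the doubled namespace component `ResolutionOfSingularities` is forced
set_option linter.dupNamespace false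

namespace Summit.ResolutionOfSingularities.ResolutionOfSingularities.Theorems

open CampaignW46 CampaignW46.HypersurfacesCharTwo

/-- [OURS · L1 W4.6 rung (ii), every `n`; NOT a statement of the manuscript]
`CampaignW46HypersurfacesEmbDimNearPointUnique 2 n` holds (`hypersurface_nearPoint_unique`). [folklore] -/
theorem campaignW46HypersurfacesEmbDimNearPointUnique_two (n : ℕ) :
    CampaignW46HypersurfacesEmbDimNearPointUnique 2 n :=
  fun _ _ _ c i τ τ' hM he hτ hτ' => hypersurface_nearPoint_unique c i τ τ' hM he hτ hτ'

/-- [OURS · L1 W4.6 rung (ii), every `n`; NOT a statement of the manuscript]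
`CampaignW46HypersurfacesEmbDimNearPointExists 2 n` holds (`hypersurface_exists_double_successor_iff_four_le_mu`).
[cite: GreuelPfister2026, Thm 3.5 and Cor 3.7] -/
theorem campaignW46HypersurfacesEmbDimNearPointExists_two (n : ℕ) :
    CampaignW46HypersurfacesEmbDimNearPointExists 2 n :=
  fun hn _ _ _ c hM hI he => hypersurface_exists_double_successor_iff_four_le_mu hn c hM hI he

/-- [OURS · L1 W4.6 rung (ii), every `n`; NOT a statement of the manuscript]
`CampaignW46HypersurfacesEmbDimSingularBranch 2 n` holds (`hypersurface_singularBranch_exact`).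
[cite: GreuelPfister2026, Thm 3.5 and Cor 3.7] -/
theorem campaignW46HypersurfacesEmbDimSingularBranch_two (n : ℕ) :
    CampaignW46HypersurfacesEmbDimSingularBranch 2 n :=
  fun hn _ _ _ c₀ hM hI he => hypersurface_singularBranch_exact hn c₀ hM hI he

/-- [OURS · L1 W4.6 rung (ii), every `n`; NOT a statement of the manuscript]
`CampaignW46HypersurfacesEmbDimPolarCorank 2 n` holds: `e(c) + rank (polar matrix) = n`
(`milnorEmbDim_add_rank_polarMatrix`; the statement's explicit matrix is `polarMatrix (ser 2 n κ c)` by `rfl`).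
[folklore] -/
theorem campaignW46HypersurfacesEmbDimPolarCorank_two (n : ℕ) :
    CampaignW46HypersurfacesEmbDimPolarCorank 2 n :=
  fun _ _ _ _ hM => milnorEmbDim_add_rank_polarMatrix hM

/-- [OURS · L1 W4.6 rung (ii); NOT a statement of the manuscript] The four rev-2 predicates at `p = 2`, every
dimension at once. [folklore] -/
theorem campaignW46HypersurfacesEmbDim_two_all' :
    (∀ n, CampaignW46HypersurfacesEmbDimNearPointUnique 2 n) ∧
      (∀ n, CampaignW46HypersurfacesEmbDimNearPointExists 2 n) ∧
      (∀ n, CampaignW46HypersurfacesEmbDimSingularBranch 2 n) ∧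
      (∀ n, CampaignW46HypersurfacesEmbDimPolarCorank 2 n) :=
  ⟨campaignW46HypersurfacesEmbDimNearPointUnique_two, campaignW46HypersurfacesEmbDimNearPointExists_two,
    campaignW46HypersurfacesEmbDimSingularBranch_two, campaignW46HypersurfacesEmbDimPolarCorank_two⟩

end Summit.ResolutionOfSingularities.ResolutionOfSingularities.Theorems

end
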